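import Literature.IUT.LogVolume.PacketDifferentSharp
import Literature.IUT.LogVolume.TensorPacketContentVolume
import Literature.RingTheory.Etale.FiniteEtaleTraceDual
import HarnessLib

/-!
# The SHARP CONVERSE of [IUTchIV] Prop. 1.1: `u·(R_I)^∼ ⊆ R_I` forces `ord ψ_J(u) ≥ d_I − d_{L_J}` at every
# factor field `L_J` of the packet (the trace form of `V/ℚ_p`; Dedekind–Euler conductor/different)

abc-iut cell, seat abc-iut-w6-d018 (R2 TARGET #1 «Rest_lower», part 1 of 2). [IUTchIV] Prop. 1.1 (kurims p. 9;
abc-iut-S5's `PacketDifferent.prop11_holds`) gives `p^{d_{I*}}·(R_I)^∼ ⊆ R_I` for the tensor packet ring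
`R_I = ⊗_{ℤ_p} R_i` inside `V = ⊗_{ℚ_p} k_i ≅ ∏_J L_J` (`ψ = dEquiv`, `(R_I)^∼ = ψ⁻¹(∏ O_{L_J})`). HERE the converse
direction, which the volume computations of [IUTchIII] Cor. 3.12 / [IUTchIV] Thm. 1.10 Step (v) need for a LOWER
bound (sequel file `TensorPacketContentSharp`): ANY `u ∈ V` with `u·(R_I)^∼ ⊆ R_I` has
`‖ψ_J(u)‖ ≤ p^{−(d_I − d_{L_J})}` for every `J`, `d_I = Σ d_i`, `d_{L_J}` the order of the different of `L_J/ℚ_p`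
— so Prop. 1.1 is sharp exactly up to `d_{L_J} − d_*` (zero for `j+1` copies of one Galois field; the equal-factor
pure-tensor case `∏‖x_i‖ ≤ p^{−(|I|−1)·d_K}` is abc-iut-w4-d072's `PacketDifferentSharp`, via the diagonal idempotent;
HERE arbitrary factor fields `k_i`, arbitrary `u ∈ V`, and the bound at every factor field `L_J` of `ψ`).
* `dual_one_eq_spanSingleton_inv`, `norm_trace_le_one_of_norm_mul_le_one`,
  `norm_mul_le_one_of_forall_norm_trace_mul_le_one` — one field: the trace dual of `𝒪_K` is `𝔇⁻¹ = δ⁻¹𝒪_K` in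
  both directions, norm currency (Mathlib `coeIdeal_differentIdeal`, `FractionalIdeal.dual`; the pattern of
  abc-iut-S5's `IntegralBases.norm_mul_le_one_of_traceDual`);
* `exists_norm_le_norm_of_mem_logUnits` — `log_p(R^×)` has an element of largest norm (bounded by [IUTchIV]
  Prop. 1.2 (i), nonzero, discrete norms);
* `trace_eq_sum_trace_dEquiv` — `Tr_{V/ℚ_p} = Σ_J Tr_{L_J/ℚ_p} ∘ ψ_J`; `norm_trace_mul_purePacket_le_one` —
  `Tr_{V/ℚ_p}(a·⊗y_i) ∈ ℤ_p` for `a ∈ R_I`, `y_i ∈ 𝔇_i⁻¹` (abc-iut-S6's `trace_purePacket`);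
* **`norm_dEquiv_le_of_smul_normalizedPacket_subset`** — the sharp converse (test `u·ψ⁻¹(0,…,o,…,0)·⊗δ_i⁻¹`
  against the trace form: `Tr_{L_J/ℚ_p}(ψ_J(u)·∏σ_{iJ}(δ_i)⁻¹·o) ∈ ℤ_p` for all `o ∈ O_{L_J}`, hence
  `ψ_J(u)·∏σ_{iJ}(δ_i)⁻¹ ∈ 𝔇_{L_J}⁻¹`; the `σ_{iJ}` are isometries); pure-tensor form
  `prod_norm_le_of_purePacket_smul_normalizedPacket_subset`.
Classical (Dedekind/Euler: the conductor of an order contains the quotient of differents; Serre, Corps locaux III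
§3, §6); the tags record the cell's typing of [IUTchIV] §1. [cite: Mochizuki2012, IUTchIV Prop. 1.1 p. 9,
Prop. 1.2 (i) p. 10] No side taken on [IUTchIII] Cor. 3.12 [claim: Mochizuki2012, status: disputed].
PROOF-ONLY file: no definitions, no named `Prop` facts.
-/

noncomputable section

open Set Module Function
open scoped Pointwise TensorProduct NormedField nonZeroDivisors

namespace Literature.IUT.LogVolume

/-! ## One field: the trace dual of `𝒪_K` is `𝔇⁻¹` (both directions, norm currency) -/

section OneField

variable {p : ℕ} [Fact p.Prime]
variable {K : Type} [NontriviallyNormedField K] [NormedAlgebra ℚ_[p] K] [IsUltrametricDist K]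
  [ProperSpace K]

/-- The trace dual of `R = 𝒪_K` is `δ⁻¹·R` for a generator `δ` of the different (Mathlib
`coeIdeal_differentIdeal`, as in `IntegralBases.norm_mul_le_one_of_traceDual`). [cite: Mochizuki2012, IUTchIV Prop. 1.1 p. 9] -/
theorem dual_one_eq_spanSingleton_inv [FiniteDimensional ℚ_[p] K] {δ : Valued.integer K}
    (hδ : different p K = Ideal.span {δ}) :
    FractionalIdeal.dual ℤ_[p] ℚ_[p] (1 : FractionalIdeal (Valued.integer K)⁰ K) =
      FractionalIdeal.spanSingleton (Valued.integer K)⁰ ((δ : K)⁻¹) := by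
  classical
  have h := coeIdeal_differentIdeal ℤ_[p] ℚ_[p] K (Valued.integer K)
  rw [← different_eq, hδ, FractionalIdeal.coeIdeal_span_singleton] at h
  rw [← inv_inv (FractionalIdeal.dual ℤ_[p] ℚ_[p] _), ← h, FractionalIdeal.spanSingleton_inv]
  rfl

/-- **`Tr_{K/ℚ_p}(𝔇⁻¹) ⊆ ℤ_p`** in norm currency: if `‖δ·z‖ ≤ 1` for a generator `δ` of the different, then
`‖Tr_{K/ℚ_p}(z)‖ ≤ 1` (abc-iut-w4-d072's `norm_trace_generator_inv_mul_le_one` at `v = δ·z`).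
[cite: Mochizuki2012, IUTchIV Prop. 1.1 p. 9] -/
theorem norm_trace_le_one_of_norm_mul_le_one {δ : Valued.integer K} (hδ : different p K = Ideal.span {δ})
    {z : K} (hz : ‖(δ : K) * z‖ ≤ 1) : ‖Algebra.trace ℚ_[p] K z‖ ≤ 1 := by
  have hδ0 : (δ : K) ≠ 0 := by exact_mod_cast generator_ne_zero p K hδ
  have h := norm_trace_generator_inv_mul_le_one p K hδ ((δ : K) * z) hz
  rwa [← mul_assoc, inv_mul_cancel₀ hδ0, one_mul] at h

/-- **The dual of `𝒪_K` lies in `𝔇⁻¹`** in norm currency: if `‖Tr_{K/ℚ_p}(z·w)‖ ≤ 1` for all `w ∈ 𝒪_K`, then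
`‖δ·z‖ ≤ 1` for a generator `δ` of the different. [cite: Mochizuki2012, IUTchIV Prop. 1.1 p. 9] -/
theorem norm_mul_le_one_of_forall_norm_trace_mul_le_one {δ : Valued.integer K}
    (hδ : different p K = Ideal.span {δ}) {z : K}
    (h : ∀ w : K, ‖w‖ ≤ 1 → ‖Algebra.trace ℚ_[p] K (z * w)‖ ≤ 1) : ‖(δ : K) * z‖ ≤ 1 := by
  classical
  haveI := finiteDimensional p K
  have h10 : (1 : FractionalIdeal (Valued.integer K)⁰ K) ≠ 0 := one_ne_zero
  have hδ0 : (δ : K) ≠ 0 := by exact_mod_cast generator_ne_zero p K hδ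
  have hmem : z ∈ FractionalIdeal.dual ℤ_[p] ℚ_[p] (1 : FractionalIdeal (Valued.integer K)⁰ K) := by
    rw [FractionalIdeal.mem_dual h10]
    intro a ha
    obtain ⟨a', rfl⟩ := (FractionalIdeal.mem_one_iff (S := (Valued.integer K)⁰)).mp ha
    refine ⟨⟨Algebra.trace ℚ_[p] K (z * (a' : K)), h _ (Valued.integer.norm_le_one a')⟩, ?_⟩
    rw [Algebra.traceForm_apply, PadicInt.algebraMap_apply]
    rfl
  rw [dual_one_eq_spanSingleton_inv hδ, FractionalIdeal.mem_spanSingleton] at hmem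
  obtain ⟨w, hw⟩ := hmem
  have hw' : (δ : K) * z = w := by
    rw [← hw, Algebra.smul_def, mul_left_comm, mul_inv_cancel₀ hδ0, mul_one]
    rfl
  rw [hw']
  exact Valued.integer.norm_le_one w

end OneField

section MaxNorm

/-- **`log_p(R^×)` has an element of largest norm** (it is a bounded subset of `K` — [IUTchIV] Prop. 1.2 (i)
`log_p(R^×) ⊆ p^{−b}R` — containing `p^a R ∋ p^N ≠ 0`, and the norms of `K^×` are the discrete values `p^{−n/e}`).
[cite: Mochizuki2012, IUTchIV Prop. 1.2 (i) p. 10] -/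
theorem exists_norm_le_norm_of_mem_logUnits (p : ℕ) [Fact p.Prime] (K : Type) [NontriviallyNormedField K]
    [NormedAlgebra ℚ_[p] K] [IsUltrametricDist K] [ProperSpace K] :
    ∃ c ∈ logUnits K, c ≠ 0 ∧ ∀ z ∈ logUnits K, ‖z‖ ≤ ‖c‖ := by
  have hp : p.Prime := Fact.out
  have hp1 : (1 : ℝ) < p := by exact_mod_cast hp.one_lt
  have hp0 : (0 : ℝ) < p := by linarith
  set e := absRamificationIdx p K with he
  have he0 : (0 : ℝ) < e := by exact_mod_cast absRamificationIdx_pos p K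
  -- the exponents `n` realised by nonzero elements of `log_p(R^×)`
  set S : Set ℤ := {n | ∃ z ∈ logUnits K, z ≠ 0 ∧ ‖z‖ = (p : ℝ) ^ (-((n : ℝ) / e))} with hS
  -- nonempty: `p^N ∈ p^a·R ⊆ log_p(R^×)`
  have hne : ∃ n : ℤ, n ∈ S := by
    set a := logRadiusA p (absRamificationIdx p K) with ha
    obtain ⟨N, hN⟩ := exists_nat_ge a
    have hz0 : ((p : K) ^ N) ≠ 0 := pow_ne_zero _ (prime_ne_zero p K)
    have hzmem : (p : K) ^ N ∈ logUnits K := by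
      refine pBall_logRadiusA_subset_logUnits p K ?_
      rw [mem_pBall_iff, norm_pow, norm_prime p K, inv_pow, ← zpow_natCast, ← zpow_neg, ← ha]
      rw [← Real.rpow_intCast]
      push_cast
      exact Real.rpow_le_rpow_of_exponent_le hp1.le (by linarith)
    obtain ⟨n, hn⟩ := exists_norm_eq_rpow p K hz0
    exact ⟨n, (p : K) ^ N, hzmem, hz0, hn⟩
  -- bounded below: `‖z‖ ≤ p^b`
  have hbd : ∃ lb : ℤ, ∀ n : ℤ, n ∈ S → lb ≤ n := by
    set b := logRadiusB p (absRamificationIdx p K) with hb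
    refine ⟨⌊-(b * e)⌋, fun n hn => ?_⟩
    obtain ⟨z, hz, -, hzn⟩ := hn
    have hle := logUnits_subset_pBall_neg_logRadiusB p K hz
    rw [mem_pBall_iff, neg_neg, hzn, Real.rpow_le_rpow_left_iff hp1] at hle
    have : -(b * e) ≤ (n : ℝ) := by
      have h1 : -((n : ℝ) / e) * e = -(n : ℝ) := by field_simp
      nlinarith
    exact Int.floor_le_iff.mpr (by linarith)
  obtain ⟨n₀, hn₀S, hmin⟩ := Int.exists_least_of_bdd hbd hne
  obtain ⟨c, hc, hc0, hcn⟩ := hn₀S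
  refine ⟨c, hc, hc0, fun z hz => ?_⟩
  by_cases hz0 : z = 0
  · rw [hz0, norm_zero]; exact norm_nonneg _
  obtain ⟨n, hn⟩ := exists_norm_eq_rpow p K hz0
  have hle : n₀ ≤ n := hmin n ⟨z, hz, hz0, hn⟩
  rw [hn, hcn]
  refine Real.rpow_le_rpow_of_exponent_le hp1.le (neg_le_neg ?_)
  exact div_le_div_of_nonneg_right (by exact_mod_cast hle) he0.le

end MaxNorm

/-! ## The packet: trace along `ψ`, trace integrality of `R_I` against `⊗𝔇_i⁻¹` -/

section Packet

variable (p : ℕ) [Fact p.Prime]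
variable {I : Type} [Fintype I] [DecidableEq I] [Nonempty I]
variable (k : I → Type) [∀ i, NontriviallyNormedField (k i)] [∀ i, NormedAlgebra ℚ_[p] (k i)]
  [∀ i, IsUltrametricDist (k i)] [∀ i, ProperSpace (k i)]

omit [DecidableEq I] [Nonempty I] [∀ i, IsUltrametricDist (k i)] in
/-- **`Tr_{V/ℚ_p} = Σ_J Tr_{L_J/ℚ_p} ∘ ψ_J`** along the chosen decomposition `ψ : V ≃ ∏_J L_J` (the trace is
invariant under algebra isomorphisms and additive over finite products). [cite: Mochizuki2012, IUTchIV Prop. 1.4 (i) p. 13] -/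
theorem trace_eq_sum_trace_dEquiv (z : PacketAlgebra p k) :
    Algebra.trace ℚ_[p] (PacketAlgebra p k) z = ∑ J, Algebra.trace ℚ_[p] (DFac p k J) (dEquiv p k z J) := by
  rw [← Algebra.trace_eq_of_algEquiv (dEquiv p k) z]
  exact Literature.RingTheory.Etale.trace_pi_apply (DFac p k) (dEquiv p k z)

omit [DecidableEq I] [Nonempty I] in
/-- **`Tr_{V/ℚ_p}(a·⊗y_i) ∈ ℤ_p` for `a ∈ R_I` and `y_i ∈ 𝔇_i⁻¹`** (`‖δ_i y_i‖ ≤ 1`): on integer pure tensors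
`Tr(⊗(x_i y_i)) = ∏ Tr_{k_i/ℚ_p}(x_i y_i)` with `x_i y_i ∈ 𝔇_i⁻¹`; then additivity (`R_I` is the additive
group generated by them) and the ultrametric inequality of `ℚ_p`. [cite: Mochizuki2012, IUTchIV Prop. 1.1 p. 9] -/
theorem norm_trace_mul_purePacket_le_one (δ : Π i, Valued.integer (k i))
    (hδ : ∀ i, different p (k i) = Ideal.span {δ i}) {y : Π i, k i} (hy : ∀ i, ‖(δ i : k i) * y i‖ ≤ 1)
    {a : PacketAlgebra p k} (ha : a ∈ integerPacket p k) :
    ‖Algebra.trace ℚ_[p] (PacketAlgebra p k) (a * purePacket p k y)‖ ≤ 1 := by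
  refine integerPacket_induction p k
    (C := fun t => ‖Algebra.trace ℚ_[p] (PacketAlgebra p k) (t * purePacket p k y)‖ ≤ 1) ?_ ?_ ?_ ?_ ha
  · intro x hx
    rw [purePacket_mul, trace_purePacket, norm_prod]
    refine Finset.prod_le_one (fun i _ => norm_nonneg _) fun i _ => ?_
    refine norm_trace_le_one_of_norm_mul_le_one (hδ i) ?_
    rw [Pi.mul_apply, mul_left_comm, norm_mul]
    calc ‖x i‖ * ‖(δ i : k i) * y i‖ ≤ 1 * 1 := by
          gcongr
          · exact hx i
          · exact hy i
      _ = 1 := one_mul _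
  · rw [zero_mul, map_zero, norm_zero]; exact zero_le_one
  · intro a b ha hb
    rw [add_mul, map_add]
    exact (IsUltrametricDist.norm_add_le_max _ _).trans (max_le ha hb)
  · intro a ha
    rwa [neg_mul, map_neg, norm_neg]

/-- `ψ⁻¹(0,…,0,o,0,…,0) ∈ (R_I)^∼` for `‖o‖ ≤ 1` (`ψ((R_I)^∼)` is the unit polydisc).
[cite: Mochizuki2012, IUTchIV Prop. 1.4 (i) p. 13] -/
theorem dEquiv_symm_single_mem_normalizedPacket [DecidableEq (DIdx p k)] (J : DIdx p k) {o : DFac p k J}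
    (ho : ‖o‖ ≤ 1) : (dEquiv p k).symm (Pi.single J o) ∈ normalizedPacket p k := by
  have himg : dEquiv p k ((dEquiv p k).symm (Pi.single J o)) ∈
      dEquiv p k '' (normalizedPacket p k : Set (PacketAlgebra p k)) := by
    rw [AlgEquiv.apply_symm_apply, image_normalizedPacket_eq_coe, coe_piUnitBallStructure, mem_polydisc]
    intro J'
    by_cases hJ : J' = J
    · subst hJ; rwa [Pi.single_eq_same]
    · rw [Pi.single_eq_of_ne hJ, norm_zero]; exact zero_le_one
  exact ((dEquiv p k).injective.mem_set_image).mp himg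

/-! ## The sharp converse of [IUTchIV] Prop. 1.1 -/

/-- **THE SHARP CONVERSE OF [IUTchIV] PROP. 1.1.** If `u·(R_I)^∼ ⊆ R_I` for an element `u` of the packet
`V = ⊗_{ℚ_p} k_i`, then for EVERY factor `L_J` of the chosen decomposition `ψ : V ≅ ∏_J L_J`,
`‖ψ_J(u)‖ ≤ p^{−(d_I − d_{L_J})}`, `d_I = Σ_i d_i` the packet's different exponent and `d_{L_J}` that of
`L_J/ℚ_p`. (Prop. 1.1 supplies such `u` of order `d_{I*} = d_I − d_*`; since `L_J ⊇ σ_{*J}(k_*)` one has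
`d_{L_J} ≥ d_*`, with equality when the `k_i` are one Galois field — then Prop. 1.1 is sharp.) Proof: for
`o ∈ O_{L_J}` the element `x = ψ⁻¹(0,…,o,…,0)` lies in `(R_I)^∼`, so `u·x ∈ R_I` and
`Tr_{V/ℚ_p}(u·x·⊗δ_i⁻¹) = Tr_{L_J/ℚ_p}(ψ_J(u·⊗δ_i⁻¹)·o) ∈ ℤ_p`; hence `ψ_J(u)·∏_iσ_{iJ}(δ_i)⁻¹ ∈ 𝔇_{L_J}⁻¹`,
and the `σ_{iJ}` are isometries. [cite: Mochizuki2012, IUTchIV Prop. 1.1 p. 9] -/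
theorem norm_dEquiv_le_of_smul_normalizedPacket_subset {u : PacketAlgebra p k}
    (hu : u • (normalizedPacket p k : Set (PacketAlgebra p k)) ⊆ (integerPacket p k : Set (PacketAlgebra p k)))
    (J : DIdx p k) :
    ‖dEquiv p k u J‖ ≤ (p : ℝ) ^ (-(dSum p k - differentOrd p (DFac p k J))) := by
  classical
  have hp : p.Prime := Fact.out
  have hp1 : (1 : ℝ) < p := by exact_mod_cast hp.one_lt
  have hp0 : (0 : ℝ) < p := by linarith
  -- generators of the differents
  have hgen := fun i => exists_different_eq_span p (k i)
  choose δ hδ using hgen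
  obtain ⟨δJ, hδJ⟩ := exists_different_eq_span p (DFac p k J)
  have hδ0 : ∀ i, (δ i : k i) ≠ 0 := fun i => by exact_mod_cast generator_ne_zero p (k i) (hδ i)
  have hδJ0 : (δJ : DFac p k J) ≠ 0 := by exact_mod_cast generator_ne_zero p (DFac p k J) hδJ
  -- the test pure tensor `⊗δ_i⁻¹`
  set y : Π i, k i := fun i => (δ i : k i)⁻¹ with hydef
  have hy : ∀ i, ‖(δ i : k i) * y i‖ ≤ 1 := fun i => by
    rw [hydef, mul_inv_cancel₀ (hδ0 i), norm_one]
  -- for every `o ∈ O_{L_J}`: `Tr_{L_J/ℚ_p}(ψ_J(u·⊗y)·o) ∈ ℤ_p`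
  have key : ∀ o : DFac p k J, ‖o‖ ≤ 1 →
      ‖Algebra.trace ℚ_[p] (DFac p k J) (dEquiv p k (u * purePacket p k y) J * o)‖ ≤ 1 := by
    intro o ho
    set x := (dEquiv p k).symm (Pi.single J o) with hxdef
    have hx : x ∈ normalizedPacket p k := dEquiv_symm_single_mem_normalizedPacket p k J ho
    have hux : u * x ∈ integerPacket p k := hu (Set.smul_mem_smul_set hx)
    have htr := norm_trace_mul_purePacket_le_one p k δ hδ hy hux
    rw [trace_eq_sum_trace_dEquiv] at htr
    have hvan : ∀ J', J' ≠ J → dEquiv p k (u * x * purePacket p k y) J' = 0 := by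
      intro J' hJ'
      rw [map_mul, map_mul, hxdef, AlgEquiv.apply_symm_apply, Pi.mul_apply, Pi.mul_apply,
        Pi.single_eq_of_ne hJ', mul_zero, zero_mul]
    have hat : dEquiv p k (u * x * purePacket p k y) J = dEquiv p k (u * purePacket p k y) J * o := by
      rw [map_mul, map_mul, hxdef, AlgEquiv.apply_symm_apply, Pi.mul_apply, Pi.mul_apply,
        Pi.single_eq_same, map_mul, Pi.mul_apply]
      ring
    rw [Fintype.sum_eq_single J (fun J' hJ' => by rw [hvan J' hJ', map_zero]), hat] at htr
    exact htr
  have hz := norm_mul_le_one_of_forall_norm_trace_mul_le_one hδJ key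
  -- read the norms: `‖ψ_J(⊗y)‖ = ∏ ‖δ_i‖⁻¹ = p^{d_I}`, `‖δJ‖ = p^{−d_{L_J}}`
  have hnormy : ‖dEquiv p k (purePacket p k y) J‖ = (p : ℝ) ^ dSum p k := by
    rw [psi_purePacket_apply, norm_prod, dSum, Real.rpow_sum_of_pos hp0]
    refine Finset.prod_congr rfl fun i _ => ?_
    rw [norm_factorEmb, hydef, norm_inv, norm_eq_rpow_neg_differentOrd p (k i) (hδ i)
      (generator_ne_zero p (k i) (hδ i)), ← Real.rpow_neg hp0.le, neg_neg]
  have hnormJ : ‖(δJ : DFac p k J)‖ = (p : ℝ) ^ (-differentOrd p (DFac p k J)) :=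
    norm_eq_rpow_neg_differentOrd p (DFac p k J) hδJ (generator_ne_zero p (DFac p k J) hδJ)
  rw [map_mul, Pi.mul_apply, norm_mul, norm_mul, hnormy, hnormJ] at hz
  -- `p^{−d_J} · ‖ψ_J u‖ · p^{d_I} ≤ 1`
  have hpow : (p : ℝ) ^ (-differentOrd p (DFac p k J)) * (p : ℝ) ^ dSum p k =
      (p : ℝ) ^ (dSum p k - differentOrd p (DFac p k J)) := by
    rw [← Real.rpow_add hp0]; ring_nf
  have hpos : 0 < (p : ℝ) ^ (dSum p k - differentOrd p (DFac p k J)) := Real.rpow_pos_of_pos hp0 _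
  have h1 : ‖dEquiv p k u J‖ * (p : ℝ) ^ (dSum p k - differentOrd p (DFac p k J)) ≤ 1 := by
    rw [← hpow]; linarith [hz, mul_comm ((p : ℝ) ^ (-differentOrd p (DFac p k J))) (‖dEquiv p k u J‖ * (p : ℝ) ^ dSum p k)]
  rw [Real.rpow_neg hp0.le, ← one_div]
  exact (le_div_iff₀ hpos).mpr h1

/-- **Pure-tensor form of the sharp converse**: if `(⊗w_i)·(R_I)^∼ ⊆ R_I` then `∏_i ‖w_i‖ ≤ p^{−(d_I − d_{L_J})}`
for every factor `L_J` (the component embeddings `k_i → L_J` are isometries).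
[cite: Mochizuki2012, IUTchIV Prop. 1.1 p. 9] -/
theorem prod_norm_le_of_purePacket_smul_normalizedPacket_subset {w : Π i, k i}
    (hw : purePacket p k w • (normalizedPacket p k : Set (PacketAlgebra p k)) ⊆
      (integerPacket p k : Set (PacketAlgebra p k))) (J : DIdx p k) :
    ∏ i, ‖w i‖ ≤ (p : ℝ) ^ (-(dSum p k - differentOrd p (DFac p k J))) := by
  have h := norm_dEquiv_le_of_smul_normalizedPacket_subset p k hw J
  rw [psi_purePacket_apply, norm_prod] at h
  simp_rw [norm_factorEmb] at h
  exact h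

end Packet

end Literature.IUT.LogVolume

end
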